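import Literature.AlgebraicGeometry.Motives.HodgeStructureLefschetzGroupInvariantsHodgeClasses
import Literature.AlgebraicGeometry.Motives.HodgeStructureLefschetzGroupPowersInvariantsRational
import Literature.AlgebraicGeometry.Motives.MumfordTateGroupDiagonal
import HarnessLib

/-!
# Milne 1999 §4, "Lefschetz classes and Hodge classes", FOR THE POWERS `A^r`: under the DIAGONAL actions of `Hg(H)(ℂ)`
# and `S(H)(ℂ)` on `⋀_ℚ(V^{⊕ι})`, "`H^{2*}(A^r)^{Hg(A)} = H(A^r)`", Cor. 4.5 "`H^{2*}(A^r)^{L(A)} = D(A^r)`", and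
# Prop. 4.8 (c) ⟹ (a): `Hg′(A) = S(A)` ⟹ NO POWER of `A` supports an exotic Hodge class

[topic AlgebraicGeometry/Motives]

Layer `Literature/AlgebraicGeometry/Motives`, lane `lit-hodgefound` (Track 2 foundations library; seat `lit-hodgefound-p34`,
generation 26, self-proposed row g26-#2 of `run/shared/lean/pub/lit-hodgefound/SKELETON.md`). THEOREMS ONLY (no definition,
no named fact; net debt `0`). Sequel of g26-#1 `Motives/HodgeStructureLefschetzGroupInvariantsHodgeClasses` (`r = 1`), read
on the power Hodge structure `H₀^{⊕ι} = HodgeStructure.pi (fun _ : ι ↦ H₀)` on `ι → V` with the polarization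
`Q₀^{⊕ι} = Polarization.pi (fun _ ↦ Q₀)` (`ι` finite non-empty, "`r ≥ 1`"), through the tree's DIAGONAL descriptions of both
groups on `K`-points: `Hg(H₀^{⊕ι})(K) = Δ Hg(H₀)(K)` (`hodgeGroupBaseChange_pi_const_eq`, `Motives/MumfordTateGroupDiagonal`,
Moonen (1.13)) and `S(H₀^{⊕ι})(K) = Δ S(H₀)(K)` (Milne Prop. 1.5; g19 `…LefschetzGroupFiniteDirectSumPoints`, g25-#4
`Polarization.forall_piDiagEmbedding_map_eq_iff`), `Δ = piDiagEmbedding K V ι`.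

## The source, verbatim

J. S. Milne, *Lefschetz classes on abelian varieties*, Duke Math. J. **96** (1999) 639–675 [Milne1999LefschetzClasses] (held
`paper:doi-10-1215-s0012-7094-99-09620-5`; PDF page = printed page − 638). p0021 L24–L26 (p. 659): "**Corollary 4.5.** For
any abelian variety `A` and any `r ≥ 0`, `H^{2*}(A^r)(*)^{L(A)} = D_hom(A^r)_k`." p0022 L22–L36 (p. 660): "The Hodge group
`Hg(A)` of `A` is defined to be the largest algebraic subgroup of `GL(V_B(A)) × 𝔾_m` fixing all the Hodge classes on `A` and
its powers. It has the property that `H^{2*}(A^r)(*)^{Hg(A)} = H(A^r)` for all `r` (Deligne 1982, proof of Proposition 3.4).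
[…] Clearly `D_hom(A) ⊂ H(A)`, and so `L(A) ⊃ Hg(A)`. A Hodge class not in `D_hom(A)` will be said to be *exotic*.
**Proposition 4.8.** The following conditions on an abelian variety `A` are equivalent: (a) no power of `A` supports an exotic
Hodge class; (b) `Hg(A) = L(A)`; (c) `Hg′(A) = S(A)`; Proof. The groups `Hg(A)` and `L(A)` are the largest algebraic subgroups
of `GL(H¹(A)) × 𝔾_m` fixing respectively the Hodge classes and the Lefschetz classes on the powers of `A`, and conversely,
these are precisely the classes fixed by the two groups. Hence `H(A^r) = D(A^r)` for all `r ⟺ Hg(A) = L(A)`." p. 653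
(p0015 L20–L23): "From the canonical isomorphisms `H¹(A) = V(A)^∨`, `H¹(A^r) ≅ rH¹(A)`, `H^*(A^r) ≅ ⋀ H¹(A^r)`, we obtain an
action of `S(A)` on `H^*(A^r)` for all `r`." B. Moonen, *Notes on Mumford–Tate groups* (1999) [Moonen1999MTNotes] (1.13):
the Hodge group of `V^{⊕n}` is `Hg(V)` acting diagonally.

## What is PROVED (`ι` finite non-empty; `Θ = toComplexAlg (ι → V)`; `Bᵖ(H₀^{⊕ι}) = ((pi H₀).exteriorPower (2p)).hodgeClasses (p n)`,
`Dᵖ(H₀^{⊕ι}) = (pi H₀).divisorClasses p`; `Δ = piDiagEmbedding`)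

* §1 "`H^{2*}(A^r)^{Hg(A)} = H(A^r)`": `forall_piDiagEmbedding_map_eq_iff_forall_hodgeGroupBaseChange_pi` (fixed by
  `⋀(Δγ₀)` for all `γ₀ ∈ Hg(H₀)(K)` iff fixed by `⋀(γ)` for all `γ ∈ Hg(H₀^{⊕ι})(K)`),
  **`mem_hodgeClasses_exteriorPower_pi_iff_forall_piDiagEmbedding_map_toComplexAlg_eq`** (for `p + p = k n`: `x ∈ ⋀ᵏ_ℚ(V^{⊕ι})`
  is a Hodge class of type `(p, p)` iff `Θ x` is fixed by the diagonal action of `Hg(H₀)(ℂ)` — any weight).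
* §2 COR. 4.5 FOR `A^r`: **`Polarization.forall_piDiagEmbedding_map_toComplexAlg_eq_iff_mem_divisorClasses_pi`** (odd weight;
  `x ∈ ⋀^{2p}_ℚ(V^{⊕ι})`: `Θ x` fixed by the diagonal `S(H₀)(ℂ)` iff `x ∈ Dᵖ(H₀^{⊕ι})`), the set form
  `Polarization.setOf_mem_and_forall_piDiagEmbedding_map_toComplexAlg_eq_eq_map_divisorClasses_pi`, and "`D(A^r) ⊂ H(A^r)`"
  read backwards in every weight: `Polarization.mem_hodgeClasses_pi_of_forall_piDiagEmbedding_map_toComplexAlg_eq`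
  (diagonally `S(H₀)(ℂ)`-invariant ⟹ Hodge class).
* §3 PROP. 4.8 (c) ⟹ (a) WITH ALL POWERS: `Polarization.hodgeGroupBaseChange_pi_const_eq_lefschetzGroupBaseChange_of_eq`
  (`Hg(H₀)(K) = S(H₀)(K) ⟹ Hg(H₀^{⊕ι})(K) = S(H₀^{⊕ι})(K)`, every field `K ⊇ ℚ`),
  **`Polarization.divisorClasses_pi_eq_hodgeClasses_of_hodgeGroupBaseChange_eq`** (`Hg(H₀)(ℂ) = S(H₀)(ℂ) ⟹
  Dᵖ(H₀^{⊕ι}) = Bᵖ(H₀^{⊕ι})` for every finite non-empty `ι` and every `p`: no power of `A` supports an exotic Hodge class),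
  its weight-one reading, and the pointwise converse
  `Polarization.forall_piDiagEmbedding_map_toComplexAlg_eq_of_forall_divisorClasses_pi_eq` (`Dᵖ = Bᵖ` on `H₀^{⊕ι}` for all `p`
  ⟹ the Hodge classes of `⋀^{2•}(H₀^{⊕ι})` are fixed by the diagonal `S(H₀)(ℂ)`).

## Lean encoding, differences

As in g26-#1: "fixed by the algebraic group over `ℚ`" is read on `ℂ`-points, `x ↦ Θ x = x ⊗ 1`; Milne's `L(A)`-invariants of
the Tate-twisted cohomology are the `S(A) = Ker l(A)`-invariants. `r ≥ 1` only (`[Nonempty ι]`; `r = 0` is `H^*(A⁰) = ℚ`).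
Prop. 4.8 is proved as (c) ⟹ (a) (all powers) and (a) ⟹ "every Hodge class on every power is fixed by `S(A)`"; the remaining
step "(a) ⟹ `Hg′(A) = S(A)`" is the statement that `Hg` and `S` are the LARGEST algebraic subgroups fixing the respective
classes (Thm. 4.4 via Deligne 1982, 3.1 (c)), not available for the point groups — NOT here.

## References
* [Milne1999LefschetzClasses] J. S. Milne, *Lefschetz classes on abelian varieties*, Duke Math. J. 96 (1999), §4 Cor. 4.5
  (p. 659), p. 660, Prop. 4.8; §3 p. 653 L20–L23, p. 654 L16–L17; §1 Prop. 1.5.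
* [Moonen1999MTNotes] B. Moonen, *Notes on Mumford–Tate groups* (1999), (1.8), (1.13).
* [Lange2023AbelianVarietiesComplex] H. Lange, *Abelian Varieties over the Complex Numbers* (2023), §7.2.2 Thm. 7.2.4, §7.3.1.
-/

open scoped TensorProduct

namespace Literature.AlgebraicGeometry.Motives

namespace HodgeStructure

open ExteriorLefschetz ExteriorAlgebra

universe u uK

/-! ### §1 "`H^{2*}(A^r)^{Hg(A)} = H(A^r)`": the Hodge classes of `⋀ᵏ(H₀^{⊕ι})` are the diagonal `Hg(H₀)(ℂ)`-invariants -/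

section HodgeGroup

variable (K : Type uK) [Field K] [Algebra ℚ K] {ι : Type} [Fintype ι] [DecidableEq ι] [Nonempty ι]
  {V : Type u} [AddCommGroup V] [Module ℚ V] [Module.Finite ℚ V] [HodgeTensorFacts.{u, u}] {n : ℤ} (H₀ : HodgeStructure V n)

/-- **`Hg(A^r) = Hg(A)` acting diagonally, for the action on `⋀`**: an element of `⋀(K ⊗ V^{⊕ι})` is fixed by `⋀(Δγ₀)` for
every `γ₀ ∈ Hg(H₀)(K)` iff it is fixed by `⋀(γ)` for every `γ ∈ Hg(H₀^{⊕ι})(K)` (the tree's `hodgeGroupBaseChange_pi_const_eq`: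
`Hg(H₀^{⊕ι})(K) = Δ Hg(H₀)(K)`). [cite: Moonen1999MTNotes, (1.13)] [cite: Milne1999LefschetzClasses, §4 p. 660 L22–L26] -/
theorem forall_piDiagEmbedding_map_eq_iff_forall_hodgeGroupBaseChange_pi (x : ExteriorAlgebra K (K ⊗[ℚ] (ι → V))) :
    (∀ γ₀ ∈ H₀.hodgeGroupBaseChange K,
        ExteriorAlgebra.map (piDiagEmbedding K V ι γ₀ : (K ⊗[ℚ] (ι → V)) →ₗ[K] (K ⊗[ℚ] (ι → V))) x = x) ↔
      ∀ γ ∈ (HodgeStructure.pi fun _ : ι ↦ H₀).hodgeGroupBaseChange K,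
        ExteriorAlgebra.map (γ : (K ⊗[ℚ] (ι → V)) →ₗ[K] (K ⊗[ℚ] (ι → V))) x = x := by
  rw [hodgeGroupBaseChange_pi_const_eq (H := H₀) (ι := ι) K]
  constructor
  · rintro h _ ⟨γ₀, h₀, rfl⟩
    exact h γ₀ h₀
  · intro h γ₀ h₀
    exact h _ ⟨γ₀, h₀, rfl⟩

/-- **"`H^{2*}(A^r)(*)^{Hg(A)} = H(A^r)` for all `r`" (Deligne 1982, proof of Prop. 3.4) on the carrier**: for
`p + p = k n`, a rational class `x ∈ ⋀ᵏ_ℚ(V^{⊕ι})` is a Hodge class of `⋀ᵏ(H₀^{⊕ι})` of type `(p, p)` iff `Θ x = x ⊗ 1` is fixed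
by the DIAGONAL action `⋀(Δγ₀)` of every `γ₀ ∈ Hg(H₀)(ℂ)` — g26-#1's `Θ`-form of the tree's Thm. 7.2.4 for `H₀^{⊕ι}`, and
`Hg(H₀^{⊕ι})(ℂ) = Δ Hg(H₀)(ℂ)`. Any weight. [cite: Milne1999LefschetzClasses, §4 p. 660 L22–L26] [cite: Moonen1999MTNotes, (1.13)]
[cite: Lange2023AbelianVarietiesComplex, §7.2.2 Thm. 7.2.4] -/
theorem mem_hodgeClasses_exteriorPower_pi_iff_forall_piDiagEmbedding_map_toComplexAlg_eq {k : ℕ} {p : ℤ}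
    (hp : p + p = k * n) (x : ⋀[ℚ]^k (ι → V)) :
    x ∈ ((HodgeStructure.pi fun _ : ι ↦ H₀).exteriorPower k).hodgeClasses p ↔ ∀ γ₀ ∈ H₀.hodgeGroupBaseChange ℂ,
      ExteriorAlgebra.map (piDiagEmbedding ℂ V ι γ₀ : (ℂ ⊗[ℚ] (ι → V)) →ₗ[ℂ] (ℂ ⊗[ℚ] (ι → V)))
        (toComplexAlg (ι → V) (x : ExteriorAlgebra ℚ (ι → V))) = toComplexAlg (ι → V) (x : ExteriorAlgebra ℚ (ι → V)) := by
  rw [(HodgeStructure.pi fun _ : ι ↦ H₀).mem_hodgeClasses_exteriorPower_iff_forall_hodgeGroupBaseChange_map_toComplexAlg_eq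
    hp x, forall_piDiagEmbedding_map_eq_iff_forall_hodgeGroupBaseChange_pi ℂ H₀]

end HodgeGroup

/-! ### §2 Corollary 4.5 for `A^r`: `H^{2p}(A^r, ℚ)^{S(A)} = Dᵖ(A^r)` under the diagonal action -/

section Powers

variable {ι : Type} [Fintype ι] [DecidableEq ι] [Nonempty ι] {V : Type u} [AddCommGroup V] [Module ℚ V] [Module.Finite ℚ V]
  {n : ℤ} {H₀ : HodgeStructure V n} (Q₀ : Polarization H₀)

/-- **"`D(A^r) ⊂ H(A^r)`" read backwards, any weight**: for `p + p = k n`, a rational class `x ∈ ⋀ᵏ_ℚ(V^{⊕ι})` whose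
complexification is fixed by the diagonal action of every `γ₀ ∈ S(H₀)(ℂ)` is a Hodge class of `⋀ᵏ(H₀^{⊕ι})` of type `(p, p)`
(`S(H₀^{⊕ι})(ℂ) = Δ S(H₀)(ℂ) ⊇ Hg(H₀^{⊕ι})(ℂ)`; g26-#1 for `H₀^{⊕ι}`). [cite: Milne1999LefschetzClasses, §4 p. 660 L33–L35 and §1 Prop. 1.5] -/
theorem Polarization.mem_hodgeClasses_pi_of_forall_piDiagEmbedding_map_toComplexAlg_eq {k : ℕ} {p : ℤ}
    (hp : p + p = k * n) {x : ⋀[ℚ]^k (ι → V)}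
    (hx : ∀ γ₀ ∈ Q₀.lefschetzGroupBaseChange ℂ,
      ExteriorAlgebra.map (piDiagEmbedding ℂ V ι γ₀ : (ℂ ⊗[ℚ] (ι → V)) →ₗ[ℂ] (ℂ ⊗[ℚ] (ι → V)))
        (toComplexAlg (ι → V) (x : ExteriorAlgebra ℚ (ι → V))) = toComplexAlg (ι → V) (x : ExteriorAlgebra ℚ (ι → V))) :
    x ∈ ((HodgeStructure.pi fun _ : ι ↦ H₀).exteriorPower k).hodgeClasses p := by
  haveI : HodgeTensorFacts.{u, u} := hodgeTensorFacts_holds.{u, u}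
  exact (Polarization.pi fun _ : ι ↦ Q₀).mem_hodgeClasses_of_forall_lefschetzGroupBaseChange_map_toComplexAlg_eq hp
    ((Q₀.forall_piDiagEmbedding_map_eq_iff ℂ _).1 hx)

/-- **Milne 1999, Cor. 4.5 for `A^r` on the carrier (odd weight, `k = ℚ`, `r = |ι| ≥ 1`)**: for a rational class
`x ∈ ⋀^{2p}_ℚ(V^{⊕ι})`, `Θ x` is fixed by the diagonal action `⋀(Δγ₀)` of every `γ₀ ∈ S(H₀)(ℂ)` ("the action of `S(A)` on
`H^*(A^r)`") iff `x` is a divisor class of the power, `x ∈ Dᵖ(H₀^{⊕ι})` ("`H^{2*}(A^r)(*)^{L(A)} = D_hom(A^r)_k`",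
`Ker l(A) = S(A)`) — "`S(A) = S(A^r)`" (Prop. 1.5, g25-#4 `forall_piDiagEmbedding_map_eq_iff`) and g26-#1's Cor. 4.5 for the
polarized Hodge structure `(H₀^{⊕ι}, Q₀^{⊕ι})`. [cite: Milne1999LefschetzClasses, §4 Cor. 4.5 (p. 659), §3 p. 653 L20–L23, p. 654 L16–L17]
[cite: Lange2023AbelianVarietiesComplex, §7.3.1] -/
theorem Polarization.forall_piDiagEmbedding_map_toComplexAlg_eq_iff_mem_divisorClasses_pi (hn : Odd n) {p : ℕ}
    (x : ⋀[ℚ]^(2 * p) (ι → V)) :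
    (∀ γ₀ ∈ Q₀.lefschetzGroupBaseChange ℂ,
        ExteriorAlgebra.map (piDiagEmbedding ℂ V ι γ₀ : (ℂ ⊗[ℚ] (ι → V)) →ₗ[ℂ] (ℂ ⊗[ℚ] (ι → V)))
          (toComplexAlg (ι → V) (x : ExteriorAlgebra ℚ (ι → V))) = toComplexAlg (ι → V) (x : ExteriorAlgebra ℚ (ι → V))) ↔
      x ∈ (HodgeStructure.pi fun _ : ι ↦ H₀).divisorClasses p := by
  rw [Q₀.forall_piDiagEmbedding_map_eq_iff ℂ,
    (Polarization.pi fun _ : ι ↦ Q₀).forall_lefschetzGroupBaseChange_map_toComplexAlg_eq_iff_mem_divisorClasses hn x]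

/-- **"`H^{2p}(A^r, ℚ)^{S(A)} = Dᵖ(A^r)`" as subsets of `⋀_ℚ(V^{⊕ι})`** (odd weight): the rational `2p`-vectors whose
complexification is fixed by the diagonal `S(H₀)(ℂ)` are exactly (the image of) `Dᵖ(H₀^{⊕ι})`.
[cite: Milne1999LefschetzClasses, §4 Cor. 4.5 (p. 659), p. 654 L16–L17] [cite: Lange2023AbelianVarietiesComplex, §7.3.1] -/
theorem Polarization.setOf_mem_and_forall_piDiagEmbedding_map_toComplexAlg_eq_eq_map_divisorClasses_pi (hn : Odd n) (p : ℕ) :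
    {x : ExteriorAlgebra ℚ (ι → V) | x ∈ ⋀[ℚ]^(2 * p) (ι → V) ∧ ∀ γ₀ ∈ Q₀.lefschetzGroupBaseChange ℂ,
        ExteriorAlgebra.map (piDiagEmbedding ℂ V ι γ₀ : (ℂ ⊗[ℚ] (ι → V)) →ₗ[ℂ] (ℂ ⊗[ℚ] (ι → V)))
          (toComplexAlg (ι → V) x) = toComplexAlg (ι → V) x} =
      ↑(((HodgeStructure.pi fun _ : ι ↦ H₀).divisorClasses p).map (⋀[ℚ]^(2 * p) (ι → V)).subtype) := by
  rw [← (Polarization.pi fun _ : ι ↦ Q₀).setOf_mem_and_forall_lefschetzGroupBaseChange_map_toComplexAlg_eq_eq_map_divisorClasses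
    hn p]
  ext x
  simp only [Set.mem_setOf_eq, Polarization.forall_piDiagEmbedding_map_eq_iff ℂ Q₀]

/-- **"`H^{2*}(A^r, ℚ)^{S(A)}` is the `ℚ`-algebra generated by `H²_Hodge(A^r)`"** (odd weight): the rational classes of
`⋀_ℚ(V^{⊕ι})` whose complexification is fixed by the diagonal `S(H₀)(ℂ)` form the `ℚ`-subalgebra generated by the degree-two
Hodge classes `B¹(H₀^{⊕ι})` of type `(n, n)`. [cite: Milne1999LefschetzClasses, §3 Thm. 3.2 (p. 653), §4 Cor. 4.5 (p. 659)]
[cite: Lange2023AbelianVarietiesComplex, §7.3.1] -/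
theorem Polarization.setOf_forall_piDiagEmbedding_map_toComplexAlg_eq_eq_adjoin_hodgeClasses_two (hn : Odd n) :
    {x : ExteriorAlgebra ℚ (ι → V) | ∀ γ₀ ∈ Q₀.lefschetzGroupBaseChange ℂ,
        ExteriorAlgebra.map (piDiagEmbedding ℂ V ι γ₀ : (ℂ ⊗[ℚ] (ι → V)) →ₗ[ℂ] (ℂ ⊗[ℚ] (ι → V)))
          (toComplexAlg (ι → V) x) = toComplexAlg (ι → V) x} =
      ↑(Algebra.adjoin ℚ ((((HodgeStructure.pi fun _ : ι ↦ H₀).exteriorPower 2).hodgeClasses n).map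
        (⋀[ℚ]^2 (ι → V)).subtype : Set (ExteriorAlgebra ℚ (ι → V)))) := by
  rw [← (Polarization.pi fun _ : ι ↦ Q₀).setOf_forall_lefschetzGroupBaseChange_map_toComplexAlg_eq_eq_adjoin_hodgeClasses_two
    hn]
  ext x
  simp only [Set.mem_setOf_eq, Polarization.forall_piDiagEmbedding_map_eq_iff ℂ Q₀]

/-- **Exotic classes on the powers**: a Hodge class of `⋀^{2p}(H₀^{⊕ι})` lies outside `Dᵖ(H₀^{⊕ι})` iff some `γ₀ ∈ S(H₀)(ℂ)`,
acting diagonally, moves its complexification (odd weight). [cite: Milne1999LefschetzClasses, §4 p. 660 L35–L36 and Prop. 4.8 (a)] -/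
theorem Polarization.not_mem_divisorClasses_pi_iff_exists_lefschetzGroupBaseChange (hn : Odd n) {p : ℕ}
    (x : ⋀[ℚ]^(2 * p) (ι → V)) :
    x ∉ (HodgeStructure.pi fun _ : ι ↦ H₀).divisorClasses p ↔ ∃ γ₀ ∈ Q₀.lefschetzGroupBaseChange ℂ,
      ExteriorAlgebra.map (piDiagEmbedding ℂ V ι γ₀ : (ℂ ⊗[ℚ] (ι → V)) →ₗ[ℂ] (ℂ ⊗[ℚ] (ι → V)))
        (toComplexAlg (ι → V) (x : ExteriorAlgebra ℚ (ι → V))) ≠ toComplexAlg (ι → V) (x : ExteriorAlgebra ℚ (ι → V)) := by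
  rw [← Q₀.forall_piDiagEmbedding_map_toComplexAlg_eq_iff_mem_divisorClasses_pi hn x]
  push Not
  rfl

/-- **Prop. 4.8, (a) read pointwise on the power `A^r`**: if `Dᵖ(H₀^{⊕ι}) = Bᵖ(H₀^{⊕ι})` for every `p` (no exotic Hodge class on
this power), then every Hodge class of `⋀^{2p}(H₀^{⊕ι})` has complexification fixed by the diagonal `S(H₀)(ℂ)` (odd weight).
[cite: Milne1999LefschetzClasses, §4 Prop. 4.8 (proof, p. 660)] -/
theorem Polarization.forall_piDiagEmbedding_map_toComplexAlg_eq_of_forall_divisorClasses_pi_eq (hn : Odd n)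
    (hBD : ∀ p : ℕ, (HodgeStructure.pi fun _ : ι ↦ H₀).divisorClasses p =
      ((HodgeStructure.pi fun _ : ι ↦ H₀).exteriorPower (2 * p)).hodgeClasses (p * n))
    {p : ℕ} {x : ⋀[ℚ]^(2 * p) (ι → V)}
    (hx : x ∈ ((HodgeStructure.pi fun _ : ι ↦ H₀).exteriorPower (2 * p)).hodgeClasses (p * n)) :
    ∀ γ₀ ∈ Q₀.lefschetzGroupBaseChange ℂ,
      ExteriorAlgebra.map (piDiagEmbedding ℂ V ι γ₀ : (ℂ ⊗[ℚ] (ι → V)) →ₗ[ℂ] (ℂ ⊗[ℚ] (ι → V)))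
        (toComplexAlg (ι → V) (x : ExteriorAlgebra ℚ (ι → V))) = toComplexAlg (ι → V) (x : ExteriorAlgebra ℚ (ι → V)) :=
  (Q₀.forall_piDiagEmbedding_map_toComplexAlg_eq_iff_mem_divisorClasses_pi hn x).2 ((hBD p).symm ▸ hx)

end Powers

/-! ### §3 Proposition 4.8 (c) ⟹ (a): `Hg′(A) = S(A)` ⟹ no power of `A` supports an exotic Hodge class -/

section NoExotic

variable (K : Type uK) [Field K] [Algebra ℚ K] {ι : Type} [Fintype ι] [DecidableEq ι] [Nonempty ι]
  {V : Type u} [AddCommGroup V] [Module ℚ V] [Module.Finite ℚ V] [HodgeTensorFacts.{u, u}] {n : ℤ} {H₀ : HodgeStructure V n}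
  (Q₀ : Polarization H₀)

/-- **`Hg(H₀)(K) = S(H₀)(K) ⟹ Hg(H₀^{⊕ι})(K) = S(H₀^{⊕ι})(K)`** (every field `K ⊇ ℚ`, `ι` finite non-empty): both groups of the
power are the diagonal images `Δ Hg(H₀)(K)`, `Δ S(H₀)(K)` (Moonen (1.13); Milne Prop. 1.5 / Cor. 4.7 `S(A^r) ≅ S(A)`).
[cite: Milne1999LefschetzClasses, §1 Prop. 1.5 and §4 Cor. 4.7] [cite: Moonen1999MTNotes, (1.13)] -/
theorem Polarization.hodgeGroupBaseChange_pi_const_eq_lefschetzGroupBaseChange_of_eq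
    (hHg : H₀.hodgeGroupBaseChange K = Q₀.lefschetzGroupBaseChange K) :
    (HodgeStructure.pi fun _ : ι ↦ H₀).hodgeGroupBaseChange K = (Polarization.pi fun _ : ι ↦ Q₀).lefschetzGroupBaseChange K := by
  rw [hodgeGroupBaseChange_pi_const_eq (H := H₀) (ι := ι) K, hHg,
    Polarization.lefschetzGroupBaseChange_pi_const_eq_map_piDiagEmbedding (K := K) (ι := ι) Q₀]

/-- **Prop. 4.8, (c) ⟹ (a): if `Hg(H₀)(ℂ) = S(H₀)(ℂ)` then NO POWER `H₀^{⊕ι}` supports an exotic Hodge class** —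
`Dᵖ(H₀^{⊕ι}) = Bᵖ(H₀^{⊕ι}) = Hdg^{pn}(⋀^{2p}(H₀^{⊕ι}))` for every finite non-empty `ι` and every `p` (odd weight): by the previous
theorem `Hg(H₀^{⊕ι})(ℂ) = S(H₀^{⊕ι})(ℂ)`, and g26-#1's Prop. 4.8 (c) ⟹ (a) for the polarized Hodge structure
`(H₀^{⊕ι}, Q₀^{⊕ι})`. (`r = 1` is g26-#1 itself.) [cite: Milne1999LefschetzClasses, §4 Prop. 4.8 (p. 660)] -/
theorem Polarization.divisorClasses_pi_eq_hodgeClasses_of_hodgeGroupBaseChange_eq (hn : Odd n)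
    (hHg : H₀.hodgeGroupBaseChange ℂ = Q₀.lefschetzGroupBaseChange ℂ) (p : ℕ) :
    (HodgeStructure.pi fun _ : ι ↦ H₀).divisorClasses p =
      ((HodgeStructure.pi fun _ : ι ↦ H₀).exteriorPower (2 * p)).hodgeClasses (p * n) :=
  (Polarization.pi fun _ : ι ↦ Q₀).divisorClasses_eq_hodgeClasses_of_hodgeGroupBaseChange_eq hn
    (Q₀.hodgeGroupBaseChange_pi_const_eq_lefschetzGroupBaseChange_of_eq ℂ hHg) p

/-- **Weight one** (`H₀ = H¹(A, ℚ)`, `H₀^{⊕ι} = H¹(A^r, ℚ)`, `Bᵖ(A^r) = Hdgᵖ(⋀^{2p} H¹(A^r))` the Hodge classes of codimension `p`):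
`Hg(A)(ℂ) = S(A)(ℂ) ⟹ Dᵖ(A^r) = Bᵖ(A^r)` for all `r ≥ 1` and all `p`. [cite: Milne1999LefschetzClasses, §4 Prop. 4.8 (p. 660)] -/
theorem Polarization.divisorClasses_pi_eq_hodgeClasses_weightOne_of_hodgeGroupBaseChange_eq {H₀ : HodgeStructure V 1}
    (Q₀ : Polarization H₀) (hHg : H₀.hodgeGroupBaseChange ℂ = Q₀.lefschetzGroupBaseChange ℂ) (p : ℕ) :
    (HodgeStructure.pi fun _ : ι ↦ H₀).divisorClasses p =
      ((HodgeStructure.pi fun _ : ι ↦ H₀).exteriorPower (2 * p)).hodgeClasses p := by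
  simpa using Q₀.divisorClasses_pi_eq_hodgeClasses_of_hodgeGroupBaseChange_eq (ι := ι) odd_one hHg p

end NoExotic

end HodgeStructure

end Literature.AlgebraicGeometry.Motives
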